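import Mathlib
import HarnessLib
import Summits.HubbardSuperconductivity.HubbardSuperconductivity.Theorems.KLProgrammeKLRegimeVolumeLimitNestedRates
import Summits.HubbardSuperconductivity.HubbardSuperconductivity.Theorems.KLProgrammeKLRegimeVolumeLimitNestedPoisson

/-!
# VL child `KLRegimeVolumeLimitV14` (stmt-HubbardSuperconductivity-19921), «cauchy» v2: the registered `stub_vl_rates`
# FROM POSITION-SPACE DATA ON NESTED TORI — periodisation comparability + a first site moment
# (cell gate-hubbard-kl, seat hubbard-kl-k3c5-p3 g5, technique «OS-positivity-free direct assembly»; `--supports` 19921)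

`…VolumeLimitNestedRates` reduces `stub_vl_rates` to (b1n) nested density comparisons, (b2n) a nested same-momentum rate of `klSixInf` and
(b2m) a one-volume momentum modulus of `klSixInf`; `…VolumeLimitNestedPoisson` writes `klSixInf L β U μ n = torusFourier (sixSite_L n)` with the
site kernel `sixSite_L n z = (∫₀^β e^{−iω_n u} S∞_L(z,u) du)/D∞_L` (`klSixInf_eq_torusFourier`) and turns (b2n)/(b2m) into statements about that
kernel (Poisson on nested tori; first site moment).  Composing the two:

* `stub_vl_rates_of_sitePeriodisation_V14` — **the registered `stub_vl_rates` text VERBATIM** from, in the stub's own regime prefix,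
  (S) nested comparability IN POSITION SPACE: `L₀ ≤ L`, `L″ = b·L` ⇒ `‖klOccInf L − klOccInf L″‖ ≤ ρ₁ L` and
      `Σ_{y ∈ Λ_L} ‖sixSite_L n y − Σ_{x ≡ y (mod L)} sixSite_{L″} n x‖ ≤ ρ₂ L` (`ρ₁, ρ₂ → 0`; the torus-`L` kernel against the PERIODISED
      torus-`L″` kernel — two finite volumes, no limit object), and
  (D) an `L`-uniform FIRST SITE MOMENT `Σ_z ‖z̃‖₁ ‖sixSite_L n z‖ ≤ D` (`z̃` = centred representative).
This is the export form an inductive two-volume pass of the expansion in position space produces (decay of the six-point kernel in the torus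
distance, uniform in the volume; comparability of the scale-by-scale kernels of the torus-`L` expansion with the periodised torus-`L″` ones).

Everything is proved; no definition; nothing is asserted about the model.
-/

noncomputable section

namespace Summit.HubbardSuperconductivity.HubbardSuperconductivity.Theorems.TwoPointAssembly

set_option linter.dupNamespace false -- summit = problem name (single-conjunct summit), D-0017

open Finset Filter Topology Complex Literature.MathematicalPhysics.QuantumLattice Literature.Probability.LatticeModels
open Literature.MathematicalPhysics.QuantumLattice.FermiRG
open Summit.HubbardSuperconductivity.HubbardSuperconductivity.Theorems.DispersionFlow
open Summit.HubbardSuperconductivity.HubbardSuperconductivity.Theorems.KLRegimeSplit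
open Summit.HubbardSuperconductivity.HubbardSuperconductivity.Theorems.KLProgrammeLegKernels
open scoped ComplexConjugate

/-- **`stub_vl_rates` (stmt-…-19921, «cauchy» v2) FROM POSITION-SPACE DATA ON NESTED TORI.**  With the six-point site kernel
`sixSite_L n z := (∫₀^β e^{−iω_n u} klSixWordInf L β U μ z u du)/klDInf L β U μ` (written inline), IF for every datum of the registered stub
(S) `∃ L₀ ρ₁ ρ₂ → 0`: for `L₀ ≤ L` and `L″ = b·L`, `‖klOccInf L − klOccInf L″‖ ≤ ρ₁ L` and, for every Matsubara integer `n`,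
`Σ_y ‖sixSite_L n y − Σ_{x ≡ y (mod L)} sixSite_{L″} n x‖ ≤ ρ₂ L`; and (D) `∃ L₀ D`: for `L₀ ≤ L` and every `n`, `Σ_z ‖z̃‖₁ ‖sixSite_L n z‖ ≤ D`;
THEN the registered text of `stub_vl_rates` holds verbatim. -/
theorem stub_vl_rates_of_sitePeriodisation_V14
    (hS : ∀ (G : GeoConsts) (P : SplitConsts) (Q : EngConsts) (R : RenConsts), G.WF → P.WF → Q.WF → R.WF →
      ∃ c₅ : ℝ, 0 < c₅ ∧ ∀ c : ℝ, 0 < c → c ≤ c₅ → ∃ U₀ : ℝ, 0 < U₀ ∧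
        ∀ μ ∈ klWindowC, ∀ U : ℝ, 0 < U → U ≤ U₀ → ∀ β : ℝ, klBetaMin ≤ β → β ≤ Real.exp (c / U ^ 2) →
          ∀ K : TrigPolyC4v, klPredsV14.frameOK R U (nScales β) μ K →
            ∀ (Lstar : ℕ) (Mstar : ℕ → ℕ), TowerP klPredsV14 G P Q R β U μ K Lstar Mstar →
              ∃ L₀ : ℕ, ∃ ρ₁ : ℕ → ℝ, ∃ ρ₂ : ℕ → ℝ, Tendsto ρ₁ atTop (𝓝 0) ∧ Tendsto ρ₂ atTop (𝓝 0) ∧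
                (∀ (L : ℕ) [NeZero L], L₀ ≤ L → ∀ (L'' : ℕ) [NeZero L''] (b : ℕ), L'' = b * L →
                  ‖klOccInf L β U μ - klOccInf L'' β U μ‖ ≤ ρ₁ L) ∧
                (∀ (L : ℕ) [NeZero L], L₀ ≤ L → ∀ (L'' : ℕ) [NeZero L''] (b : ℕ), L'' = b * L → ∀ n : ℤ,
                  ∑ y : TorusSite 2 L,
                    ‖(∫ u in (0 : ℝ)..β, Complex.exp (-(((Real.pi * (2 * (n : ℝ) + 1) / β * u : ℝ) : ℂ) * Complex.I)) *
                          klSixWordInf L β U μ y u) / klDInf L β U μ -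
                      ∑ x ∈ Finset.univ.filter (fun x : TorusSite 2 L'' => (fun i => (((x i).val : ℕ) : ZMod L)) = y),
                        (∫ u in (0 : ℝ)..β, Complex.exp (-(((Real.pi * (2 * (n : ℝ) + 1) / β * u : ℝ) : ℂ) * Complex.I)) *
                            klSixWordInf L'' β U μ x u) / klDInf L'' β U μ‖ ≤ ρ₂ L))
    (hD : ∀ (G : GeoConsts) (P : SplitConsts) (Q : EngConsts) (R : RenConsts), G.WF → P.WF → Q.WF → R.WF →
      ∃ c₅ : ℝ, 0 < c₅ ∧ ∀ c : ℝ, 0 < c → c ≤ c₅ → ∃ U₀ : ℝ, 0 < U₀ ∧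
        ∀ μ ∈ klWindowC, ∀ U : ℝ, 0 < U → U ≤ U₀ → ∀ β : ℝ, klBetaMin ≤ β → β ≤ Real.exp (c / U ^ 2) →
          ∀ K : TrigPolyC4v, klPredsV14.frameOK R U (nScales β) μ K →
            ∀ (Lstar : ℕ) (Mstar : ℕ → ℕ), TowerP klPredsV14 G P Q R β U μ K Lstar Mstar →
              ∃ L₀ : ℕ, ∃ D : ℝ, ∀ (L : ℕ) [NeZero L], L₀ ≤ L → ∀ n : ℤ,
                ∑ z : TorusSite 2 L, (∑ i, |(Torus.cRepZ (z i) : ℝ)|) *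
                  ‖(∫ u in (0 : ℝ)..β, Complex.exp (-(((Real.pi * (2 * (n : ℝ) + 1) / β * u : ℝ) : ℂ) * Complex.I)) *
                        klSixWordInf L β U μ z u) / klDInf L β U μ‖ ≤ D) :
    ∀ (G : GeoConsts) (P : SplitConsts) (Q : EngConsts) (R : RenConsts), G.WF → P.WF → Q.WF → R.WF →
      ∃ c₅ : ℝ, 0 < c₅ ∧ ∀ c : ℝ, 0 < c → c ≤ c₅ → ∃ U₀ : ℝ, 0 < U₀ ∧
        ∀ μ ∈ klWindowC, ∀ U : ℝ, 0 < U → U ≤ U₀ → ∀ β : ℝ, klBetaMin ≤ β → β ≤ Real.exp (c / U ^ 2) →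
          ∀ K : TrigPolyC4v, klPredsV14.frameOK R U (nScales β) μ K →
            ∀ (Lstar : ℕ) (Mstar : ℕ → ℕ), TowerP klPredsV14 G P Q R β U μ K Lstar Mstar →
              ∃ L₀ : ℕ, ∃ D₂ : ℝ, ∃ ρ₁ : ℕ → ℝ, ∃ ρ₂ : ℕ → ℝ, Tendsto ρ₁ atTop (𝓝 0) ∧ Tendsto ρ₂ atTop (𝓝 0) ∧
                (∀ (L : ℕ) [NeZero L], L₀ ≤ L → ∀ (L' : ℕ) [NeZero L'], L ≤ L' → ‖klOccInf L β U μ - klOccInf L' β U μ‖ ≤ ρ₁ L) ∧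
                (∀ (L : ℕ) [NeZero L], L₀ ≤ L → ∀ (L' : ℕ) [NeZero L'], L ≤ L' →
                  ∀ (n : ℤ) (k : TorusSite 2 L) (k' : TorusSite 2 L'),
                    ‖klSixInf L β U μ n k - klSixInf L' β U μ n k'‖ ≤
                      ρ₂ L + D₂ * ∑ i, torusAbs (latticeMomentum L k i - latticeMomentum L' k' i)) := by
  refine stub_vl_rates_of_nested_V14 ?_ ?_
  · -- (N): nested rates from the position-space comparability, by Poisson on nested tori
    intro G P Q R hG hP hQ hR
    obtain ⟨c₅, hc₅, hc⟩ := hS G P Q R hG hP hQ hR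
    refine ⟨c₅, hc₅, fun c hc0 hcc => ?_⟩
    obtain ⟨U₀, hU₀, hU⟩ := hc c hc0 hcc
    refine ⟨U₀, hU₀, fun μ hμ U hU0 hUU β hβmin hβmax K hK Lstar Mstar hT => ?_⟩
    have hβ : 0 < β := pos_of_klBetaMin_le hβmin
    obtain ⟨L₀, ρ₁, ρ₂, hρ₁, hρ₂, hocc, hsix⟩ := hU μ hμ U hU0 hUU β hβmin hβmax K hK Lstar Mstar hT
    refine ⟨L₀, ρ₁, ρ₂, hρ₁, hρ₂, fun L _ hL L'' _ hdvd => ?_, fun L _ hL L'' _ hdvd n k k'' hkk => ?_⟩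
    · obtain ⟨b, hb⟩ := hdvd
      exact hocc L hL L'' b (hb.trans (mul_comm _ _))
    · obtain ⟨b, hb⟩ := hdvd
      have hM : L'' = b * L := hb.trans (mul_comm _ _)
      rw [klSixInf_eq_torusFourier hβ U μ n k, klSixInf_eq_torusFourier hβ U μ n k'']
      exact (norm_torusFourier_sub_torusFourier_of_latticeMomentum_eq hM _ _ hkk).trans (hsix L hL L'' b hM n)
  · -- (M): the one-volume modulus from the first site moment (no slack: `ρ₃ = 0`)
    intro G P Q R hG hP hQ hR
    obtain ⟨c₅, hc₅, hc⟩ := hD G P Q R hG hP hQ hR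
    refine ⟨c₅, hc₅, fun c hc0 hcc => ?_⟩
    obtain ⟨U₀, hU₀, hU⟩ := hc c hc0 hcc
    refine ⟨U₀, hU₀, fun μ hμ U hU0 hUU β hβmin hβmax K hK Lstar Mstar hT => ?_⟩
    have hβ : 0 < β := pos_of_klBetaMin_le hβmin
    obtain ⟨L₀, D, hmom⟩ := hU μ hμ U hU0 hUU β hβmin hβmax K hK Lstar Mstar hT
    refine ⟨L₀, D, fun _ => 0, tendsto_const_nhds, fun L _ hL n k₁ k₂ => ?_⟩
    rw [zero_add, klSixInf_eq_torusFourier hβ U μ n k₁, klSixInf_eq_torusFourier hβ U μ n k₂]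
    refine (norm_torusFourier_sub_torusFourier_le_firstMoment _ k₁ k₂).trans ?_
    exact mul_le_mul_of_nonneg_right (hmom L hL n) (klvc_tmod_nonneg _ _)

end Summit.HubbardSuperconductivity.HubbardSuperconductivity.Theorems.TwoPointAssembly

end
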